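import Summits.BirchSwinnertonDyer.BirchSwinnertonDyer.Theorems.RamifiedSevenEllipticUnitsBottomLocalIndexSplitKummer
import Summits.BirchSwinnertonDyer.BirchSwinnertonDyer.Theorems.RamifiedSevenEllipticUnitsKummerChartInj
import Literature.NumberTheory.EllipticCurves.BurungaleKobayashiNakamuraOta2026.PadicEndSpan
import Literature.NumberTheory.EllipticCurves.CMTorsionTwistCharacterProofs
import Literature.NumberTheory.EllipticCurves.PeriodIndexCorestrictionLocal
import HarnessLib

set_option linter.dupNamespace false
set_option autoImplicit false

/-!
# Route `RamifiedSevenEllipticUnits` (rung K7r), value crux `EllipticUnitValueSevenOfGZK`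
# (stmt-BirchSwinnertonDyer-19945), line `rubin-formula-zp`, stub S_sat — RANK TWO OF `End_K(E)` AND
# THE `p`-ADIC SPAN: **every element of `𝒪_𝔭 · z = padicEndSpan z` has a non-zero integer multiple in
# `ℤ_p z + ℤ_p ψz` for ONE endomorphism `ψ`** (PROVED, any elliptic curve over a field of
# characteristic `0`; `--supports 19945`)

Cell `bsd-cm`, seat `bsd-cm-k7r-c2` g5 (CLAIM «F6 rank route» on STATUS 2026-08-27). HONEST FRAMING:
algebra of the endomorphism ring + cocycle plumbing; nothing about any curve's arithmetic is asserted;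
BSD is not proved; no named fact is minted; no definition is introduced; `sorry`-free. This is the first
half of the «GZK-free algebraic route» to (S_sat-rk) of the line card `Lines/rubin-formula-zp.md`
(«`hcZp ∧ rank_ℤ End_K(E) ≤ 2`»): the input «`rank_ℤ End_K(E) ≤ 2`» is a THEOREM of the tree in the
shape needed (Silverman, *AEC*, Cor. III.9.4 — `exists_int_quadratic_of_mem_geomEndRing`,
`exists_intCast_mul_eq_of_mem_geomEndRing`), so no hypothesis on `End_K(E)` survives.

## Results (namespace `…Theorems.RamifiedSevenEllipticUnits.EndRankTwo`)

* `exists_generator_endRing` — for `E` elliptic over `K` of characteristic `0` there is `ψ ∈ End_K(E)`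
  (`WeierstrassCurve.endRing`) such that every `c ∈ End_K(E)` satisfies `N c = a + b ψ` for integers
  `N ≠ 0`, `a`, `b` (either every `c` is commensurable with a scalar and `ψ = 0`, or some `c₀` is not,
  `ψ = 2c₀ − t` has `ψ² = t² − 4d < 0` by the positivity of the degree form, and Cor. III.9.4 applies).
* `endH1_rel`, `endPi_rel` — a ring identity `N c = a + b ψ` in `End_K(E)` acts on `H¹(H, E[m])` and on
  families: `N • (c · y) = a • y + b • (ψ · y)` (`endH1` / `endPi`; cocycle level).
* `exists_zsmul_eq_pair_of_mem_padicEndSpan` — for every `w ∈ 𝒪_𝔭 · z` (`padicEndSpan p H z`) there are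
  an integer `N ≠ 0` and `α, β ∈ ℤ_p` with `N • w = α · z + β · (ψ · z)`.

References: J. H. Silverman, *AEC* (2009), Cor. III.6.3, Thm. III.9.3, Cor. III.9.4 [SilvermanAEC2009];
S. Lang, *Elliptic Functions* (1987), Ch. 13 §2 [Lang1987]; [BKNO] arXiv:2608.06879v1 §3.3.1 (the module
`𝒪 · z(𝟙)`) [BurungaleKobayashiNakamuraOta2026]; B. Perrin-Riou, Bull. SMF 115 (1987) §0 (the
`ℤ_p`-module `S_p(L)`) [PerrinRiou1987BSMF]; cell texts `Lines/rubin-formula-zp.md`, STATUS D117.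
-/

noncomputable section

open scoped Classical

open WeierstrassCurve NumberField IsDedekindDomain Field
  Literature.NumberTheory.EllipticCurves
  Literature.NumberTheory.GaloisRepresentations

universe u

namespace Summit.BirchSwinnertonDyer.BirchSwinnertonDyer.Theorems.RamifiedSevenEllipticUnits

namespace EndRankTwo

/-! ## Part 1. `End_K(E)` is commensurable with `ℤ + ℤψ` for one `ψ` (characteristic `0`) -/

section Generator

variable {K : Type u} [Field K] [CharZero K] (V : WeierstrassCurve K) [V.IsElliptic]

/-- **One endomorphism spans `End_K(E)` rationally together with `1`.** For an elliptic curve over a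
field of characteristic `0` there is `ψ ∈ End_K(E)` such that every `c ∈ End_K(E)` satisfies
`N c = a + b ψ` with integers `N ≠ 0`, `a`, `b`. If every `c ∈ End_K(E)` is commensurable with a scalar
take `ψ = 0`; otherwise pick `c₀` which is not: it satisfies `c₀² − t c₀ + d = 0`
(`exists_int_quadratic_of_mem_geomEndRing`, Cor. III.6.3) and `ψ := 2c₀ − t ∈ End_K(E)` has
`ψ² = t² − 4d < 0` (positivity of `m² + tmn + dn²` at `(t, −2)`), so Cor. III.9.4
(`exists_intCast_mul_eq_of_mem_geomEndRing`: `End_{K̄}(E) ⊗ ℚ = ℚ(ψ)`) gives the relation for every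
`c ∈ End_K(E) ⊆ End_{K̄}(E)`. [cite: SilvermanAEC2009, Cor. III.6.3 and Cor. III.9.4] -/
theorem exists_generator_endRing :
    ∃ ψ ∈ V.endRing, ∀ c ∈ V.endRing, ∃ N a b : ℤ, N ≠ 0 ∧
      (N : AddMonoid.End V.geomPoints) * c =
        (a : AddMonoid.End V.geomPoints) + (b : AddMonoid.End V.geomPoints) * ψ := by
  by_cases hsc : ∀ c ∈ V.endRing, ∃ N a : ℤ, N ≠ 0 ∧
      (N : AddMonoid.End V.geomPoints) * c = (a : AddMonoid.End V.geomPoints)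
  · refine ⟨0, V.endRing.zero_mem, fun c hc ↦ ?_⟩
    obtain ⟨N, a, hN, h⟩ := hsc c hc
    exact ⟨N, a, 0, hN, by rw [h, Int.cast_zero, zero_mul, add_zero]⟩
  · push Not at hsc
    obtain ⟨c₀, hc₀, hns⟩ := hsc
    obtain ⟨t, d, hquad, hpos⟩ := V.exists_int_quadratic_of_mem_geomEndRing (V.endRing_le_geomEndRing hc₀)
    -- `ψ := 2 c₀ - t`
    have h2 : ((2 : ℤ) : AddMonoid.End V.geomPoints) = 2 := by push_cast; rfl
    have hψmem : (2 : AddMonoid.End V.geomPoints) * c₀ - (t : AddMonoid.End V.geomPoints) ∈ V.endRing :=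
      V.endRing.sub_mem (V.endRing.mul_mem (by rw [← h2]; exact intCast_mem V.endRing 2) hc₀)
        (intCast_mem V.endRing t)
    -- `t - 2c₀ ≠ 0` since `c₀` is not commensurable with a scalar
    have hne : (t : AddMonoid.End V.geomPoints) + ((-2 : ℤ) : AddMonoid.End V.geomPoints) * c₀ ≠ 0 := by
      intro h0
      apply hns 2 t two_ne_zero
      have e : ((-2 : ℤ) : AddMonoid.End V.geomPoints) = -((2 : ℤ) : AddMonoid.End V.geomPoints) := by
        push_cast; rfl
      rw [e, neg_mul, ← sub_eq_add_neg, sub_eq_zero] at h0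
      exact h0.symm
    have hD : t ^ 2 - 4 * d < 0 := by
      have h := hpos t (-2) hne
      nlinarith
    -- `ψ² = t² - 4d`, computed in the commutative ring `End_{K̄}(E)`
    letI : CommRing V.geomEndRing :=
      { (inferInstance : Ring V.geomEndRing) with
        mul_comm := fun x y ↦ Subtype.ext (V.geomEndRing_comm_holds _ _ x.2 y.2) }
    set x₀ : V.geomEndRing := ⟨c₀, V.endRing_le_geomEndRing hc₀⟩ with hx₀
    have h1 : x₀ * x₀ - (t : V.geomEndRing) * x₀ + (d : V.geomEndRing) = 0 :=
      Subtype.ext (by push_cast; exact hquad)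
    have hψψ' : ((2 : V.geomEndRing) * x₀ - (t : V.geomEndRing)) * ((2 : V.geomEndRing) * x₀ - t) =
        ((t ^ 2 - 4 * d : ℤ) : V.geomEndRing) := by
      push_cast
      linear_combination (4 : V.geomEndRing) * h1
    have hψψ : ((2 : AddMonoid.End V.geomPoints) * c₀ - (t : AddMonoid.End V.geomPoints)) *
        ((2 : AddMonoid.End V.geomPoints) * c₀ - (t : AddMonoid.End V.geomPoints)) =
          ((t ^ 2 - 4 * d : ℤ) : AddMonoid.End V.geomPoints) := by
      have := congrArg Subtype.val hψψ'
      push_cast at this ⊢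
      exact this
    refine ⟨(2 : AddMonoid.End V.geomPoints) * c₀ - (t : AddMonoid.End V.geomPoints), hψmem,
      fun c hc ↦ ?_⟩
    exact exists_intCast_mul_eq_of_mem_geomEndRing V (V.endRing_le_geomEndRing hψmem) hD hψψ
      (V.endRing_le_geomEndRing hc)

end Generator

/-! ## Part 2. A ring identity `N c = a + b ψ` acts on `H¹(H, E[m])` and on families -/

section Action

variable {K : Type u} [Field K] (V : WeierstrassCurve K)

/-- **`N • (c · y) = a • y + b • (ψ · y)` on `H¹(H, E[m])`** whenever `N c = a + b ψ` in `End_K(E)`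
(`endH1`, the action of `End_K(E)` on `H¹(H, E[m])` by functoriality; checked on cocycle
representatives, pointwise in `E[m] ⊆ E(K̄)`). [cite: SilvermanAEC2009, III.4 (End(E) as a ring acting on points)]
[cite: SerreGaloisCohomology1997, I.§2.4 (functoriality in the coefficients)] -/
theorem endH1_rel {c ψ : AddMonoid.End V.geomPoints} (hc : c ∈ V.endRing) (hψ : ψ ∈ V.endRing)
    {N a b : ℤ}
    (h : (N : AddMonoid.End V.geomPoints) * c =
      (a : AddMonoid.End V.geomPoints) + (b : AddMonoid.End V.geomPoints) * ψ)
    (m : ℤ) (H : Subgroup (Field.absoluteGaloisGroup K)) (y : V.torsionH1Over m H) :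
    N • V.endH1 hc m H y = a • y + b • V.endH1 hψ m H y := by
  obtain ⟨f, rfl⟩ := oneCocycleClass_surjective (discreteTopRep H (geomTorsion V m)) y
  rw [WeierstrassCurve.endH1, WeierstrassCurve.endH1, resH1Hom_oneCocycleClass, resH1Hom_oneCocycleClass,
    ← oneCocycleClassₗ_apply, ← oneCocycleClassₗ_apply, ← oneCocycleClassₗ_apply, ← map_zsmul,
    ← map_zsmul, ← map_zsmul, ← map_add]
  congr 1
  refine Subtype.ext (ContinuousMap.ext fun σ ↦ Subtype.ext ?_)
  have hpt := congrArg
    (fun e : AddMonoid.End V.geomPoints ↦ e ((f.1 σ : geomTorsion V m) : geomPoints V)) h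
  simp only [AddMonoid.End.coe_mul, Function.comp_apply, AddMonoid.End.intCast_apply] at hpt
  simp only [Submodule.coe_smul_of_tower, Submodule.coe_add, ContinuousMap.coe_smul,
    ContinuousMap.coe_add, Pi.smul_apply, Pi.add_apply, AddSubgroupClass.coe_zsmul,
    AddSubgroup.coe_add]
  exact hpt

/-- **The same on families**: `N • (c · x) = a • x + b • (ψ · x)` in `∏_k H¹(H, E[p^k])` for the
componentwise action `endPi` (level by level `endH1_rel`).
[cite: PerrinRiou1987BSMF, §0 p. 401 (componentwise structure of `S_p(L)`)] -/
theorem endPi_rel {c ψ : AddMonoid.End V.geomPoints} (hc : c ∈ V.endRing) (hψ : ψ ∈ V.endRing)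
    {N a b : ℤ}
    (h : (N : AddMonoid.End V.geomPoints) * c =
      (a : AddMonoid.End V.geomPoints) + (b : AddMonoid.End V.geomPoints) * ψ)
    (p : ℕ) (H : Subgroup (Field.absoluteGaloisGroup K)) (x : V.torsionH1Pi p H) :
    N • V.endPi hc p H x = a • x + b • V.endPi hψ p H x := by
  funext k
  exact endH1_rel V hc hψ h ((p : ℤ) ^ k) H (x k)

end Action

/-! ## Part 3. Every element of `𝒪_𝔭 · z` has a multiple in `ℤ_p z + ℤ_p ψz` -/

section Span

variable {K : Type u} [Field K] (V : WeierstrassCurve K) (p : ℕ) [Fact p.Prime]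
  (H : Subgroup (Field.absoluteGaloisGroup K))

omit [Fact p.Prime] in
/-- Every family in `∏_k H¹(H, E[p^k])` is killed level-wise by `p^k` (in the `ℤ`-form used by the
scalar lemmas of `KummerCore`). [cite: SilvermanAEC2009, VIII.§2 (cohomology of `E[m]`)] -/
theorem levelTorsion (y : V.torsionH1Pi p H) (k : ℕ) : ((p : ℤ) ^ k) • y k = 0 := by
  have h := BottomLocalIndexSplit.pow_smul_torsionH1Over_eq_zero V p k H (y k)
  rwa [← natCast_zsmul, Nat.cast_pow] at h

/-- `a • (c · y) = (a c) · y` for an integer `a` (`KummerCore.padicPi_intCast_mul_left_of_levelTorsion`,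
every family being level-torsion). [cite: PerrinRiou1987BSMF, §0 p. 401] -/
theorem zsmul_padicPi (a : ℤ) (c : ℤ_[p]) (y : V.torsionH1Pi p H) :
    a • V.padicPi p H c y = V.padicPi p H ((a : ℤ_[p]) * c) y :=
  (KummerCore.padicPi_intCast_mul_left_of_levelTorsion (levelTorsion V p H y) a c).symm

/-- `a • y = (a : ℤ_p) · y` for an integer `a`. [cite: PerrinRiou1987BSMF, §0 p. 401] -/
theorem zsmul_eq_padicPi (a : ℤ) (y : V.torsionH1Pi p H) :
    a • y = V.padicPi p H (a : ℤ_[p]) y := by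
  rw [← mul_one (a : ℤ_[p]), ← zsmul_padicPi, padicPi_one]

/-- **Every `w ∈ 𝒪_𝔭 · z` has `N • w = α · z + β · (ψ · z)` with `N ≠ 0`**, for any `ψ ∈ End_K(E)` such
that every `c ∈ End_K(E)` satisfies some `N c = a + b ψ` (`exists_generator_endRing` in characteristic
`0`): on a generator `c' · (φ · z)` of `padicEndSpan z` use `N_φ • (φ · z) = a • z + b • (ψ · z)`
(`endPi_rel`) and `c' · (a • z) = (a c') · z`; multiples of such relations add. READING: `𝒪_𝔭 · z(𝟙) ⊗ ℚ`
is spanned by `z(𝟙)` and `ψ z(𝟙)` — the `ℤ_p`-rank-two bound of the line card's GZK-free route.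
[cite: BurungaleKobayashiNakamuraOta2026, §3.3.1 (arXiv:2608.06879 p. 19) (the module `𝒪·z(𝟙)`; shape only)]
[cite: SilvermanAEC2009, Cor. III.9.4] -/
theorem exists_zsmul_eq_pair_of_mem_padicEndSpan {ψ : AddMonoid.End V.geomPoints} (hψ : ψ ∈ V.endRing)
    (hall : ∀ c ∈ V.endRing, ∃ N a b : ℤ, N ≠ 0 ∧
      (N : AddMonoid.End V.geomPoints) * c =
        (a : AddMonoid.End V.geomPoints) + (b : AddMonoid.End V.geomPoints) * ψ)
    (z : V.torsionH1Pi p H) {w : V.torsionH1Pi p H} (hw : w ∈ V.padicEndSpan p H z) :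
    ∃ N : ℤ, N ≠ 0 ∧ ∃ α β : ℤ_[p],
      N • w = V.padicPi p H α z + V.padicPi p H β (V.endPi hψ p H z) := by
  unfold padicEndSpan at hw
  induction hw using AddSubgroup.closure_induction with
  | mem y hy =>
    obtain ⟨φ, hφ, c', rfl⟩ := hy
    obtain ⟨N, a, b, hN, hrel⟩ := hall φ hφ
    refine ⟨N, hN, (a : ℤ_[p]) * c', (b : ℤ_[p]) * c', ?_⟩
    rw [← map_zsmul, endPi_rel V hφ hψ hrel, map_add, map_zsmul, map_zsmul, zsmul_padicPi,
      zsmul_padicPi]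
  | zero => exact ⟨1, one_ne_zero, 0, 0, by rw [zsmul_zero, KummerCore.padicPi_zero_left,
      KummerCore.padicPi_zero_left, add_zero]⟩
  | add u v _ _ hu hv =>
    obtain ⟨N₁, hN₁, α₁, β₁, h₁⟩ := hu
    obtain ⟨N₂, hN₂, α₂, β₂, h₂⟩ := hv
    refine ⟨N₁ * N₂, mul_ne_zero hN₁ hN₂, (N₂ : ℤ_[p]) * α₁ + (N₁ : ℤ_[p]) * α₂,
      (N₂ : ℤ_[p]) * β₁ + (N₁ : ℤ_[p]) * β₂, ?_⟩
    rw [zsmul_add, mul_comm N₁ N₂, mul_zsmul, h₁, mul_comm N₂ N₁, mul_zsmul, h₂, zsmul_add, zsmul_add,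
      zsmul_padicPi, zsmul_padicPi, zsmul_padicPi, zsmul_padicPi,
      KummerCore.padicPi_add_left_of_levelTorsion (levelTorsion V p H z),
      KummerCore.padicPi_add_left_of_levelTorsion (levelTorsion V p H _)]
    abel
  | neg u _ hu =>
    obtain ⟨N, hN, α, β, h⟩ := hu
    refine ⟨N, hN, -α, -β, ?_⟩
    rw [zsmul_neg, h, KummerCore.padicPi_neg_left_of_levelTorsion (levelTorsion V p H z),
      KummerCore.padicPi_neg_left_of_levelTorsion (levelTorsion V p H _), neg_add]

end Span

end EndRankTwo

end Summit.BirchSwinnertonDyer.BirchSwinnertonDyer.Theorems.RamifiedSevenEllipticUnits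

end
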